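import Mathlib
import HarnessLib
import HarnessLib.Audit
import Summits.HubbardSuperconductivity.Statement
import Literature.MathematicalPhysics.QuantumLattice.FockFirstQuantization
import Literature.MathematicalPhysics.QuantumLattice.HubbardLiebConfig
import Literature.MathematicalPhysics.QuantumLattice.LiebSpinReflection

/-!
Route: PositivityPins

CLOSED (retired) 2026-08-15T13:48:21Z by operator:999:1257524 — reason: not-a-thesis: assembly does not conclude the sub-problem Statement — note: D-0027 §2.1 audit (human 2026-08-15: routes that do not decide the summit are removed): the assembly concludes `AttractiveExclusion`, not the sub-problem statement; a NEW conforming route may be opened from the same idea (generated `closes : … → _root_.HubbardSuperconductivity`).. The file is kept as the record of this route; refuted decls are indexed as negative knowledge (`ledger negatives`).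

Route PositivityPins — HubbardSuperconductivity/HubbardSuperconductivity, NEGATIVE SIDE (U<0),
companion route of NoGo; realises idea card positivity-pins-characters (novelty audit:
new-combination).
TARGET = NoGo's rank-2 crux NogoAttractiveExclusion (stmt-HubbardSuperconductivity-0169; identical
signature, so the item is SHARED): for every U<0 and δ∈(0,1) some (N_L, S^z=0)-sector ground-state
sequence of hubbardTorus 2 L 1 U, N_L = 2⌊(1−δ)L²/2⌋, has no d_{x²−y²} pair-field LRO. Since the
2026-08-13 audit S is U>0 only; stmt-0169 is wanted by NoGo's thesis over U≠0 and its retriage note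
asks for 'a companion route or a standalone theorem' — this is that companion route. It contributes
to ¬S only through NoGo's own Assembly (NogoThesis → ¬HubbardSuperconductivity); no chain from U<0
facts to ¬S is claimed, and the Assembly here ends in the shared decl.
THESIS X (it suffices to show) = AttrB1gPseudoGap ∧ AttrEvenConvexity. For U<0, δ∈(0,1), even L, H_L
= hubbardTorus 2 L 1 U, E_L(M) := Matrix.minEnergyOn H_L (szSector M 0), Γ_L(γ) := the
second-quantised point-group unitary of d4Orb γ (column t ↦ C†(γt₀)⋯C†(γt_{k−1})|∅⟩, written inline
with FirstQuant.prodCreation), V_L := szSector (N_L−2) 0 ⊓ eigenspace(Γ_L(r), −1) (rotation-odd part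
of the two-fewer-particles sector):
 (G_d, rank 2)  L²·[minEnergyOn H_L V_L − E_L(N_L−2)] → +∞ — a B1g PSEUDO-GAP: no C₄-odd level
within O(L⁻²) of the (N_L−2)-particle ground state;
 (C₂, rank 3)  L²·[E_L(N_L+2) + E_L(N_L−2) − 2E_L(N_L)] ≥ −C — even (pair) convexity up to O(L⁻²).
One-line Lean form of X: `AttrB1gPseudoGap ∧ AttrEvenConvexity` (decls of this file; the whole
sketch is rc0 on the farm).
ASSEMBLY = the card's mechanism, all glue provable now: AttrB1gPseudoGap → AttrEvenConvexity →
AttractiveExclusion, by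
 (L1) TRACE LEMMA [support TraceLemma]: at U<0 the sector ground state is unique (LiebPRL1989 Thm 1;
tree lieb_attractive_holds) and its Lieb matrix is W = c·P with P ≻ 0
(IsLiebSystem.exists_posDef_eq_smul); a lattice automorphism acts on W through ONE signed
permutation M used for both spin species, W ↦ M W M⁻¹, so Γψ = χψ (uniqueness) and Tr(MWM⁻¹) = Tr W
= c·Tr P ≠ 0 force χ = 1: ψ_{N} and ψ_{N−2} are D₄-invariant for every even N;
 (L2) SCHUR: Γ(r) Δ_d Γ(r)⁻¹ = −Δ_d (dWaveFormFactor_rotate_holds), so Δ_d ψ_N ∈ V_L while ψ_{N−2} ∉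
V_L, whence minEnergyOn H_L V_L = E_L(N−2) + g_L with g_L > 0;
 (L3) CHANNEL KOMA–TASAKI [support ChannelKT, any sign of U]: the double-commutator identity
⟨Δψ,(H−E_N)Δψ⟩ + ⟨Δ†ψ,(H−E_N)Δ†ψ⟩ = ⟨ψ,[Δ†,[H,Δ]]ψ⟩ for Hψ = E_Nψ, locality (‖[Δ_d†,[H,Δ_d]]‖,
‖[Δ_d,Δ_d†]‖ ≤ cL²) and |E_{N+2} − E_N| ≤ c give Re⟨Δ_dψ, HΔ_dψ⟩ − (2E_N − E_{N+2})‖Δ_dψ‖² ≤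
C(U)·L²; since minEnergyOn is variational and Δ_dψ_N ∈ V_L this reads (g_L + Δ₂(N_L))·‖Δ_dψ_N‖² ≤ C
L², so L⁻⁴⟨ψ_N, Δ_d†Δ_d ψ_N⟩ ≤ C/(L²(g_L + Δ₂)) → 0 along even L by (G_d)+(C₂): liminf ≤ 0,
¬HasPairFieldLRO for the (unique, hence every) ground-state sequence; witnesses at odd/small L = any
sector ground state.
TWO-LAYER PLAN (D-0019): layer 1 = the two ranked cruxes (G_d), (C₂); layer 2 typed now as support
(provable now): TraceLemma, ChannelKT. Also filed as support, NOT in the Assembly chain: SignBudget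
— the card's dual half at U>0: every doped REPULSIVE sector ground state lies a uniform
Hilbert–Schmidt distance κ(U,δ) > 0 from the complex ray of positive-semidefinite Lieb matrices
(positivity forbids the correlation hole: ⟨n_x↑n_x↓⟩ ≥ ⟨n_x↑⟩² for W ⪰ 0, so the PSD minimum is the
paramagnetic Hartree–Fock energy and the correlation energy certifies the negative part) — an
independent structural theorem about the summit's own ground states and a one-line refuter test for
S-side anchors (no rotation-equivariant positive representation of a doped repulsive ground state;
dual to cards b1g-staircase-sector-characters / dwave-certifies-sign-problem). 7 items: target
(shared), 2 cruxes, assembly, 3 support.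

Rationale: WHY THIS LINE. NoGo's why-might-fail for stmt-0169 says a proof 'needs real clustering = rigorous
BCS–BEC' because uniqueness + C₄ cannot exclude 4-point d-wave LRO (tower of states). Positivity
says more than uniqueness: Lieb's W ≻ 0 pins the CHARACTERS of every attractive ground state (all
D₄-trivial, every even N — the attractive-frame version of MoreoDagotto1990's half-filled quantum
numbers), Schur then kills the ground-state-to-ground-state B1g amplitude exactly, and the
channel-resolved Koma–Tasaki identity (KomaTasaki1994 Thm 2.2, HorschVonDerLinden1988; tree
KomaTasaki.horschVonDerLinden_holds) turns 'no d-wave LRO' into a SPECTRAL statement about one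
symmetry sector that is a full power of L weaker than a gap: the U(1) tower lives in other
N-sectors, the η/pseudospin tower is rotation-even, and the cheapest rotation-odd state of an s-wave
superfluid is the d-like one-phonon combination at ≈ 2πv_s/L (BelkhirRanderia1992,
MicnasRanningerRobaszkiewicz1990). Areas imported: spin-space reflection positivity (LiebPRL1989,
Tian2004), finite-group representation theory (Schur orthogonality for C₄ ⊂ D₄),
Pitaevskii–Stringari/Koma–Tasaki first-moment sum rules; no expansion in U or 1/U. Catalogue:
spectral/operator reformulation + hidden positivity; no physical analogy is load-bearing.
RANKED CRUXES. rank 2 AttrB1gPseudoGap (G_d) — the only genuinely spectral input; a lower bound ≫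
L⁻² on a collective-mode energy of an interacting 2D superfluid has no tool today, but the
attractive model is sign-free, so (G_d) is numerically sharpenable first (projector/AF-QMC with C₄
projection in the (N−2,S^z=0) sector, L = 8–16; ED 4×4 at U=−4 as the cheapest refutation attempt).
rank 3 AttrEvenConvexity (C₂) — pair compressibility; physically Δ₂ ≈ +2/(κ_p L²) > 0
(MoreoScalapino1991 QMC equation of state), fails only with quartet binding / phase separation;
possibly provable outright in the BEC regime. Support (provable now, ranked 9): TraceLemma (~1–2k
Lean lines: unitary second quantisation of d4Orb, conjugation of creation operators, action on
liebW, Lieb's P ≻ 0), ChannelKT (~1k lines: identity + locality norms + |E_{N+2}−E_N| ≤ c),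
SignBudget (U>0; the one real step is the correlation-energy floor E_GS ≤ E_free(N) + U N²/(4L²) −
c(U,δ)L², by a first-order local unitary dressing of a plane-wave Slater determinant;
LangerMattis1971-type bounds for context).
KILL CRITERIA. (i) ED/QMC exhibits a rotation-odd level in the (N_L−2, S^z=0) sector within O(L⁻²)
of E(N_L−2) that tracks L → ∞ at some (U<0, δ) ⇒ restate (G_d) on the surviving (U,δ)-region or
close; (ii) Δ₂(N_L) ≤ −c/L persisting in L (phase separation at U<0) ⇒ restate (C₂) regionally;
(iii) NoGo drops/restates stmt-0169 (tenure) ⇒ this route keeps the target as a standalone regional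
theorem (Lieb 1993 Problem 1, d-wave channel) or is closed superseded. A refutation of
TraceLemma/ChannelKT would be a bookkeeping error (finite-dimensional algebra), repaired by
restating.
NOT DECOMPOSED YET (deliberately): any regime split of (G_d) (BEC |U| ≫ t via hard-core bosons vs
BCS |U| ≪ t), translation/momentum refinements of V_L (they do not improve the power of L), the
odd-L and L ≤ 2 bookkeeping (free in the target: any sector ground state is a witness there),
extension of SignBudget to the sharper ‖W₋‖² ≥ c·min(U/t,1)² of the card (Lieb's identity E(W) =
E(|W|) − 4UΣ_x Tr(W₊L_xW₋L_x) for Hermitian W), and the U>0 reading of (L1)–(L3) as a FILTER on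
S-routes (it is a remark, not an item).
DEFINITION REQUESTED: fockMapOp (second quantisation Γ(f) of an orbital map f on the Jordan–Wigner
Fock space; today written inline in AttrB1gPseudoGap/TraceLemma).
NOVELTY and BARRIERS: see the route's Novelty / Barriers fields (nearest prior art MoreoDagotto1990,
Tian1992/Tian2004, KomaTasaki1994; barriers LROForcesLowLyingStates used as an engine,
SignProblemNPHard/GeneralizedHartreeFockNoPairing sharpened, expansions not used).

Novelty: Searched this session: crossref 'spin-reflection positivity Hubbard model ground state quantum
numbers momentum' (→ doi:10.1103/physrevb.41.9488 MoreoDagotto1990, the one structural hit),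
crossref 'negative-U Hubbard model off-diagonal long-range order rigorous Tian' (→ Tian1992
doi:10.1103/physrevb.45.3145, doi:10.1103/physrevlett.71.4238 Shen–Qiu 1993,
doi:10.1016/0038-1098(94)90255-0 Tian 1994, Yang1989), crossref 'sign structure ground state Hubbard
model nonpositive amplitude correlation energy bound' (→ LangerMattis1971
doi:10.1016/0375-9601(71)90784-5, doi:10.1063/1.2437650 Giuliani 2007: energy bounds only, nothing
on negativity of the coefficient matrix); local searchd / OpenAlex / arXiv / galaxy were unavailable
(rc 75, HTTP 429) — the card's audited searches are carried over (Tian2004 review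
doi:10.1023/b:joss.0000037214.70064.78, Tian 1998 arXiv:cond-mat/9807272, Hastings arXiv:1506.08883,
Grover–Fisher arXiv:1412.3534, LiebPRL1989, KomaTasaki1994; tree: LiebSpinReflection.lean proves
uniqueness/definiteness, no statement on characters). NEAREST PRIOR ART: MoreoDagotto1990 —
ground-state quantum numbers (total momentum, point-group character) of the HALF-FILLED REPULSIVE
model derived from Lieb's theorem, i.e. the trace lemma (L1) read in the particle–hole-twisted frame
(paywalled, acq-02127; cited from title/abstract); LiebPRL1989 (W ≻ 0 in the proof of Thm 1);
Tian1992 + Tian2004 §§3–5 (spin-reflection-positivity inequalities between lowest sector energies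
and s  [refs: 10.1103/physrevb.41.9488, 10.1103/physrevb.45.3145, 10.1103/physrevlett.71.4238, 10.1016/0038-1098(94, 10.1016/0375-9601(71, 10.1063/1.2437650, 10.1023/b:joss.0000037214.70064.78, cond-mat/9807272, 1506.08883, 1412.3534, doi:10.1103/physrevb.41.9488, doi:10.1103/physrevb.45.3145, doi:10.1103/physrevlett.71.4238, doi:10.1016/0038-1098, doi:10.1016/0375-9601, doi:10.1063/1.2437650, doi:10.1023/b, Mo]

Barriers (technique_class: spin-reflection-positivity; sector-pseudo-gap; no-go): technique_class: spin-reflection-positivity; sector-pseudo-gap; no-go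
- Literature.Barriers.HubbardSuperconductivity.LROForcesLowLyingStates: USED AS THE ENGINE, not
suffered — ChannelKT is the channel-resolved form of KT Thm 2.2 (tree LROForcesLowLyingStates_holds)
aimed into the rotation-odd subspace; the barrier's loophole for uniqueness/symmetry arguments
(Anderson tower of O(1/N) states) is closed because the U(1) tower lives in OTHER particle-number
sectors, the pseudospin (η) tower is rotation-even, and positivity puts ψ_{N−2} itself in A1g,
outside the B1g subspace that Δ_dψ_N populates; what remains is exactly the barrier's quantitative
content turned into crux (G_d): a rotation-odd level within c₀/L² of E(N−2) is what d-wave LRO would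
FORCE, and (G_d) denies it.
- Literature.Barriers.HubbardSuperconductivity.SignProblemNPHard: not met on the U<0 side (the
attractive model is sign-free; numerics for (G_d),(C₂) are evidence, never certificate); on the U>0
side SignBudget is a quantitative 'no sign-free representation in Lieb's splitting' for doped
repulsive ground states — a lower bound on negativity, not an algorithm, so no conflict with
NP-hardness.
- Literature.Barriers.HubbardSuperconductivity.GeneralizedHartreeFockNoPairing: consistent and
sharpened — the positive cone's energy minimum IS the paramagnetic (normal) Hartree–Fock value,
which has no pairing (BachLiebSolovej1994 Thm 2.11); nothing here is a quasi-free variational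
argument.
- Literature.Barriers.Hubba

Novelty grade: new-combination — ROUTE REVIEW #2 (refuter f806403a, 2026-08-15; 1st pass 7aea68c9 stamped 1901): KEEP OPEN. All 7 decls rc0 (W_hub.lean); no crux blocked, nothing refuted; briefings on 1901(addendum),1902,1903,1904,1905,1906; W_hub2.lean (attractiveExclusion_iff_frequently, sorry-free) on 1906. Layers OK: layer 1 =  (refuter refuter-rreview-route-HubbardSuperconduc-f806403a-0, 2026-08-15T13:41:04Z; prior: doi:10.1103/physrevb.41.9488 (MoreoDagotto1990: GS quantum numbers from Lieb positivity — trace lemma in the particle-hole frame), LiebPRL1989 Thm 1 (W≻0; tree lieb_core / IsLiebSystem.exists_posDef_eq_smul), KomaTasaki1994 Thm 2.2 (tree LROForcesLowLyingStates_holds; engine, channel-resolved here), doi:10.1103/physrevb.45.3145 (Tian1992: ODLRO bounds, negative-U Hubbard), doi:10.1023/b:joss.00000)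

History (route lifecycle, newest last):
- 2026-08-15T13:48:21Z · CLOSED retired — not-a-thesis: assembly does not conclude the sub-problem Statement (operator:999:1257524)

sub-problem: HubbardSuperconductivity · status: closed(retired) · opened planner-plancard-HubbardSuperconductivity-Hub-b8b3ace5-0 2026-08-15T10:59:38Z · rev 1 · ledger route-HubbardSuperconductivity-PositivityPins
GENERATED by the gate from the ledger (D-0016/17). Provers cite these decls: `theorem foo : Summit.HubbardSuperconductivity.HubbardSuperconductivity.Theses.PositivityPins.<Decl> := …` in Summits/HubbardSuperconductivity/HubbardSuperconductivity/Theorems/<Name>.lean.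
-/

namespace Summit.HubbardSuperconductivity.HubbardSuperconductivity.Theses.PositivityPins

open scoped BigOperators Topology Manifold Classical MeasureTheory ProbabilityTheory Matrix InnerProductSpace ComplexConjugate ContinuousMap
open Filter Set Function TopologicalSpace MeasureTheory

attribute [summit_statement] _root_.HubbardSuperconductivity

open Literature.Hubbard

/-- item stmt-HubbardSuperconductivity-0169 · target · rank 0 · open · by planner
why it might fail: Prior TRUE (unique C₄-invariant s-wave ground states, LiebPRL1989). Fails only if the doped attractive model carried d_{x²−y²} (B1g) 4-point pair LRO at some (U<0,δ) — a nematic/d-pairing instability never seen in sign-free QMC; U<0 is outside S: a refutation only prunes NoGo, never the summit.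
sources: LiebPRL1989, Tasaki1998, KomaTasaki1994, cond-mat/9311033, MoreoScalapino1991, 1806.06736
U<0: Lieb's Theorem 1 (spin-reflection positivity) gives a unique S=0 ground state for even N on the
connected torus graph (L ≥ 3, t = 1 ≠ 0), so 'some GS' = 'the GS'. Physics: on-site s-wave BCS–BEC
superconductor; the d-wave 4-point function should cluster onto |Σ_e g_d(e) F(e)|² = 0 by
C₄-invariance of the unique GS (F = anomalous n.n. amplitude in the symmetry-broken description). No
sign problem (determinant QMC weights ≥ 0) — the most reachable regional theorem; tools: Lieb
spin-space RP, Kubo–Kishi-type Gaussian domination in spin space, cluster/BEC expansions at large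
|U|. || Sources: LiebPRL1989, KuboKishi1990, Tasaki1998. || UNELABORATED: `lean check` impossible on
2026-08-13 ~06:00Z (build artefact
Literature/MathematicalPhysics/QuantumLattice/FermionOperators.olean missing; planner may not run
lake build). Written in the exact syntax of Summits/HubbardSuperconductivity/Statement.lean with
fully qualified names; refuter please elaborate. -/
@[route_item "route-HubbardSuperconductivity-PositivityPins"]
def AttractiveExclusion : Prop :=
  ∀ U : ℝ, U < 0 → ∀ δ ∈ Set.Ioo (0:ℝ) 1, ∃ (N : ℕ → ℕ) (ψ : ∀ L, Literature.MathematicalPhysics.QuantumLattice.Fock (Literature.MathematicalPhysics.QuantumLattice.Orb (Literature.MathematicalPhysics.QuantumLattice.FermionTorus 2 L))), (∀ L, N L = 2 * ⌊(1 - δ) * (L : ℝ) ^ 2 / 2⌋₊ ∧ star (ψ L) ⬝ᵥ ψ L = 1 ∧ Literature.MathematicalPhysics.QuantumLattice.IsGroundStateInSector (Literature.MathematicalPhysics.QuantumLattice.hubbardTorus 2 L 1 U) (N L) 0 (ψ L)) ∧ ¬ Literature.MathematicalPhysics.QuantumLattice.HasPairFieldLRO Literature.MathematicalPhysics.QuantumLattice.dWaveFormFactor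 N ψ

/-- item stmt-HubbardSuperconductivity-1901 · crux · rank 2 · closed · moot by None · by planner
why it might fail: Fails iff a rotation-odd level of the (N_L−2,S^z=0) sector comes within O(L⁻²) of its GS as L→∞: nematic/d-density/stripe order or phase separation (droplets: tunnelling-split C₄ multiplets) at some (U<0,δ), or v_s→0. Expected g_L≈2πv_s/L (AB phonons); no rigorous lower-bound tool for 2D modes.
sources: LiebPRL1989, KomaTasaki1994, Tasaki2019Tower, BelkhirRanderia1992, MicnasRanningerRobaszkiewicz1990, MoreoScalapino1991
[crux] B1g PSEUDO-GAP at U<0 (card item (G_d); the route's rank-2 crux). H_L = hubbardTorus 2 L 1 U,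
N_L = 2⌊(1−δ)L²/2⌋, E_L(M) = Matrix.minEnergyOn H_L (szSector M 0). Γ_L := the second-quantised 90°
rotation: the matrix whose column t (an occupation set, enumerated increasingly by t.orderEmbOfFin)
is FirstQuant.prodCreation (d4Orb (r 1) ∘ enumeration) *ᵥ vacuum = C†(r t₀)⋯C†(r t_{k−1})|∅⟩ — the
restriction of the exterior-power functor, a unitary with Γ c†_o Γ⁻¹ = c†_{r o}, Γ⁴ = 1, commuting
with H_L, N, S^z (definition item fockMapOp requested; written inline today). V_L := szSector
(N_L−2) 0 ⊓ eigenspace(toLin' Γ_L, −1) = the rotation-odd part of the two-fewer-particles sector (≠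
⊥ for L ≥ 2: every length-4 rotation orbit of configurations carries a −1 eigenvector). CLAIM: for
all U<0, δ∈(0,1): L²·(minEnergyOn H_L V_L − E_L(N_L−2)) → +∞ along even L (typed: ∀ C ∃ L₀ ∀ even L
≥ L₀, C ≤ L²·(…)). Content: no C₄-odd level within O(L⁻²) of the (N_L−2)-particle ground state. Why
weaker than a gap: the U(1)/Anderson tower sits in other N-sectors; the pseudospin (η) tower is
rotation-even; Anderson–Bogoliubov phonons at momentum 2π/L cost ≈ 2πv_s/L and their rotation-odd
(d-like) combi -/
@[route_item "route-HubbardSuperconductivity-PositivityPins"]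
def AttrB1gPseudoGap : Prop :=
  ∀ U : ℝ, U < 0 → ∀ δ ∈ Set.Ioo (0:ℝ) 1, ∀ C : ℝ, ∃ L₀ : ℕ, ∀ (L : ℕ) [NeZero L], Even L → L₀ ≤ L → C ≤ (L : ℝ) ^ 2 * ((Literature.MathematicalPhysics.QuantumLattice.hubbardTorus 2 L 1 U).minEnergyOn (Literature.MathematicalPhysics.QuantumLattice.szSector (Λ := Literature.MathematicalPhysics.QuantumLattice.FermionTorus 2 L) (2 * ⌊(1 - δ) * (L : ℝ) ^ 2 / 2⌋₊ - 2) 0 ⊓ Module.End.eigenspace (Matrix.toLin' (Matrix.of fun s t : Finset (Literature.MathematicalPhysics.QuantumLattice.Orb (Literature.MathematicalPhysics.QuantumLattice.FermionTorus 2 L)) => (Literature.MathematicalPhysics.QuantumLattice.FirstQuant.prodCreation (fun l : Fin t.card => Literature.MathematicalPhysics.QuantumLattice.d4Orb (DihedralGroup.r 1) (t.orderEmbOfFin rfl l)) *ᵥ (Literature.MathematicalPhysics.QuantumLattice.vacuum : Literature.MathematicalPhysics.QuantumLattice.Fock (Literature.MathematicalPhysics.QuantumLattice.Orb (Literature.MathematicalPhysics.QuantumLattice.FermionTorus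 2 L)))) s)) (-1)) - (Literature.MathematicalPhysics.QuantumLattice.hubbardTorus 2 L 1 U).minEnergyOn (Literature.MathematicalPhysics.QuantumLattice.szSector (Λ := Literature.MathematicalPhysics.QuantumLattice.FermionTorus 2 L) (2 * ⌊(1 - δ) * (L : ℝ) ^ 2 / 2⌋₊ - 2) 0))

/-- item stmt-HubbardSuperconductivity-1902 · crux · rank 3 · closed · moot by None · by planner
why it might fail: Fails iff L²Δ₂(N_L)→−∞ along even L: quartet binding (period-4 staggering of E(N)) or a first-order density jump at (U,δ) — Shiba-dual to a metamagnetic jump of the half-filled repulsive model; unseen in QMC; no theorem fixes the sign of Δ₂ once U≠0 (η-pairing gives only E_{N+2}≤E_N+U).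
sources: LiebPRL1989, Yang1989, MoreoScalapino1991, MicnasRanningerRobaszkiewicz1990, KomaTasaki1994, 1806.06736
[crux] EVEN (PAIR) CONVEXITY up to O(L⁻²) at U<0 (card item (C₂); rank 3). With E_L(M) =
Matrix.minEnergyOn (hubbardTorus 2 L 1 U) (szSector M 0) and N_L = 2⌊(1−δ)L²/2⌋: for all U<0,
δ∈(0,1) there are C, L₀ with −C ≤ L²·(E_L(N_L+2) + E_L(N_L−2) − 2E_L(N_L)) for all even L ≥ L₀. Role
in the Assembly: the Δ_d† side of the double-commutator identity brings in E_L(N_L+2) − E_L(N_L);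
the bound that survives is (g_L + Δ₂(N_L))‖Δ_dψ‖² ≤ C L², so Δ₂ ≥ −C/L² keeps the pseudo-gap g_L in
control (Lieb's uniqueness gives S=0 and nothing about convexity in N). Physics: Δ₂(N) = 2/(κ_pair
L²)·(1+o(1)) > 0 for a stable superfluid with finite pair compressibility (QMC equation of state of
the 2D attractive model: Moreo–Scalapino 1991; BCS–BEC crossover reviews), i.e. the claim holds with
room and even with the sign reversed to +c/L²; at weak |U| free-fermion shell effects make Δ₂
oscillate on the scale L⁻²·O(1) but E_free is convex in N. Sign-free: directly measurable (three
sector energies) by T=0 projector QMC at L = 8–20. A proof in the BEC regime (hard-core bosons with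
n.n. repulsion 2t²/|U|: pairs repel) may be within reach and would be a Literature-grade special
case (file with --supports Att -/
@[route_item "route-HubbardSuperconductivity-PositivityPins"]
def AttrEvenConvexity : Prop :=
  ∀ U : ℝ, U < 0 → ∀ δ ∈ Set.Ioo (0:ℝ) 1, ∃ C : ℝ, ∃ L₀ : ℕ, ∀ L : ℕ, Even L → L₀ ≤ L → -C ≤ (L : ℝ) ^ 2 * ((Literature.MathematicalPhysics.QuantumLattice.hubbardTorus 2 L 1 U).minEnergyOn (Literature.MathematicalPhysics.QuantumLattice.szSector (Λ := Literature.MathematicalPhysics.QuantumLattice.FermionTorus 2 L) (2 * ⌊(1 - δ) * (L : ℝ) ^ 2 / 2⌋₊ + 2) 0) + (Literature.MathematicalPhysics.QuantumLattice.hubbardTorus 2 L 1 U).minEnergyOn (Literature.MathematicalPhysics.QuantumLattice.szSector (Λ := Literature.MathematicalPhysics.QuantumLattice.FermionTorus 2 L) (2 * ⌊(1 - δ) * (L : ℝ) ^ 2 / 2⌋₊ - 2) 0) - 2 * (Literature.MathematicalPhysics.QuantumLattice.hubbardTorus 2 L 1 U).minEnergyOn (Literature.MathematicalPhysics.QuantumLattice.szSector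 (Λ := Literature.MathematicalPhysics.QuantumLattice.FermionTorus 2 L) (2 * ⌊(1 - δ) * (L : ℝ) ^ 2 / 2⌋₊) 0))

/-- item stmt-HubbardSuperconductivity-1903 · support · rank 9 · closed · moot by None · by planner
sources: LiebPRL1989, MoreoDagotto1990, Tian2004
[support] TRACE LEMMA — positivity pins the characters (card (L1); provable now, est. 1–2k Lean
lines; layer-2 glue of the Assembly). For U<0, every L ≥ 1, every γ ∈ D₄ and every (N, S^z=0)-sector
ground state ψ of hubbardTorus 2 L 1 U: Γ_L(γ) ψ = ψ, where Γ_L(γ) is the second quantisation of the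
orbital map d4Orb γ (column t ↦ FirstQuant.prodCreation (d4Orb γ ∘ t.orderEmbOfFin rfl) *ᵥ vacuum).
Proof: (a) Γ_L(γ) is unitary, Γ c†_o Γ⁻¹ = c†_{γ o} (prodCreation_vacuum_perm,
prodCreation_orderEmbOfFin_vacuum, fockExteriorEquiv), hence commutes with H_L (d4Site γ is an
automorphism of fermionTorusGraph 2 L; the on-site U term is site-permutation invariant), with N and
S^z, and preserves szSector N 0; (b) Lieb (tree lieb_attractive_holds / lieb_core, any connected
graph, t=1≠0, U<0, N even): the sector ground state is unique up to scalars — note minEnergyOn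
(szSector N 0) = groundEnergy H N because the global N-particle ground state is a singlet — so Γψ =
χψ; (c) in Lieb's coordinates ψ = Σ W_{αβ} ψ^α_↑ ⊗ ψ^β_↓ (liebW, pairSign) the automorphism replaces
each c†_{xσ} by c†_{γx,σ}, so W ↦ M W Mᵀ with the SAME signed permutation matrix M (entries ε_γ(α) =
reordering sign) on both sides, M -/
@[route_item "route-HubbardSuperconductivity-PositivityPins"]
def TraceLemma : Prop :=
  ∀ U : ℝ, U < 0 → ∀ (L : ℕ) [NeZero L] (γ : DihedralGroup 4) (N : ℕ) (ψ : Literature.MathematicalPhysics.QuantumLattice.Fock (Literature.MathematicalPhysics.QuantumLattice.Orb (Literature.MathematicalPhysics.QuantumLattice.FermionTorus 2 L))), Literature.MathematicalPhysics.QuantumLattice.IsGroundStateInSector (Literature.MathematicalPhysics.QuantumLattice.hubbardTorus 2 L 1 U) N 0 ψ → (Matrix.of fun s t : Finset (Literature.MathematicalPhysics.QuantumLattice.Orb (Literature.MathematicalPhysics.QuantumLattice.FermionTorus 2 L)) => (Literature.MathematicalPhysics.QuantumLattice.FirstQuant.prodCreation (fun l : Fin t.card => Literature.MathematicalPhysics.QuantumLattice.d4Orb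 γ (t.orderEmbOfFin rfl l)) *ᵥ (Literature.MathematicalPhysics.QuantumLattice.vacuum : Literature.MathematicalPhysics.QuantumLattice.Fock (Literature.MathematicalPhysics.QuantumLattice.Orb (Literature.MathematicalPhysics.QuantumLattice.FermionTorus 2 L)))) s) *ᵥ ψ = ψ

/-- item stmt-HubbardSuperconductivity-1904 · support · rank 9 · closed · moot by None · by planner
sources: KomaTasaki1994, HorschVonDerLinden1988, PitaevskiiStringari1991, Tasaki2019Tower
[support] CHANNEL-RESOLVED KOMA–TASAKI / HORSCH–VON DER LINDEN FIRST-MOMENT BOUND for the d-wave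
pair field (card (L3); ANY sign of U; provable now, est. ~1k Lean lines; layer-2 glue). For every U
there is C = C(U) such that for every L ≥ 1, every N with N+2 ≤ 2L², every normalised
(N,S^z=0)-sector ground state ψ of H = hubbardTorus 2 L 1 U, with Δ = pairField dWaveFormFactor L
and E_M = Matrix.minEnergyOn H (szSector M 0): Re⟨Δψ, HΔψ⟩ − (2E_N − E_{N+2})·‖Δψ‖² ≤ C·L². Proof:
for Hψ = E_Nψ and any operator A, ⟨Aψ,(H−E_N)Aψ⟩ + ⟨A†ψ,(H−E_N)A†ψ⟩ = ⟨ψ,[A†,[H,A]]ψ⟩ (expand; KT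
(2.9) is the symmetric case). Take A = Δ: Δ†ψ ∈ szSector (N+2) 0, so the second term is ≥ (E_{N+2} −
E_N)‖Δ†ψ‖² = (E_{N+2} − E_N)(‖Δψ‖² + ⟨[Δ,Δ†]⟩) by the VARIATIONAL definition of minEnergyOn;
rearrange. Inputs: ‖[Δ_d†,[H,Δ_d]]‖ ≤ c₁L² and ‖[Δ_d,Δ_d†]‖ ≤ c₂L² (sums of L² bounded local terms:
localPair has range 1, H has range-1 hopping and on-site U), and |E_{N+2} − E_N| ≤ c₃(U) uniformly
(upper: average the Rayleigh quotients of c†_{x↑}c†_{y↓}ψ over all (x,y), normaliser (L² − N/2)² ≥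
1, numerator ≤ (8|t| + 2|U|)·normaliser; lower: the same with annihilators on ψ_{N+2}). No
H-invariance or symmetry is needed here -/
@[route_item "route-HubbardSuperconductivity-PositivityPins"]
def ChannelKT : Prop :=
  ∀ U : ℝ, ∃ C : ℝ, ∀ (L : ℕ) [NeZero L] (N : ℕ) (ψ : Literature.MathematicalPhysics.QuantumLattice.Fock (Literature.MathematicalPhysics.QuantumLattice.Orb (Literature.MathematicalPhysics.QuantumLattice.FermionTorus 2 L))), N + 2 ≤ 2 * L ^ 2 → star ψ ⬝ᵥ ψ = 1 → Literature.MathematicalPhysics.QuantumLattice.IsGroundStateInSector (Literature.MathematicalPhysics.QuantumLattice.hubbardTorus 2 L 1 U) N 0 ψ → (star (Literature.MathematicalPhysics.QuantumLattice.pairField Literature.MathematicalPhysics.QuantumLattice.dWaveFormFactor L *ᵥ ψ) ⬝ᵥ (Literature.MathematicalPhysics.QuantumLattice.hubbardTorus 2 L 1 U *ᵥ (Literature.MathematicalPhysics.QuantumLattice.pairField Literature.MathematicalPhysics.QuantumLattice.dWaveFormFactor L *ᵥ ψ))).re - (2 * (Literature.MathematicalPhysics.QuantumLattice.hubbardTorus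 2 L 1 U).minEnergyOn (Literature.MathematicalPhysics.QuantumLattice.szSector (Λ := Literature.MathematicalPhysics.QuantumLattice.FermionTorus 2 L) N 0) - (Literature.MathematicalPhysics.QuantumLattice.hubbardTorus 2 L 1 U).minEnergyOn (Literature.MathematicalPhysics.QuantumLattice.szSector (Λ := Literature.MathematicalPhysics.QuantumLattice.FermionTorus 2 L) (N + 2) 0)) * (star (Literature.MathematicalPhysics.QuantumLattice.pairField Literature.MathematicalPhysics.QuantumLattice.dWaveFormFactor L *ᵥ ψ) ⬝ᵥ (Literature.MathematicalPhysics.QuantumLattice.pairField Literature.MathematicalPhysics.QuantumLattice.dWaveFormFactor L *ᵥ ψ)).re ≤ C * (L : ℝ) ^ 2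

/-- item stmt-HubbardSuperconductivity-1905 · support · rank 9 · closed · moot by None · by planner
sources: LiebPRL1989, BachLiebSolovej1994, LangerMattis1971, TroyerWiese2005, 1506.08883, 1412.3534
[support] SIGN BUDGET (U>0; card (L4) 'price of positivity'; an INDEPENDENT structural theorem about
the summit's own ground states — NOT in this route's Assembly chain; filed here because it is the
dual half of the same card; provable now with one real analytic step). For U>0, δ∈(0,1) there are
κ>0, L₀ such that for every even L ≥ L₀, every normalised (N_L,S^z=0)-sector ground state ψ of
hubbardTorus 2 L 1 U (N_L = 2n, n = ⌊(1−δ)L²/2⌋), its Lieb coefficient matrix W = liebW n ψ (Config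
× Config, ‖W‖_HS = ‖ψ‖ = 1) satisfies Re hsInner (W − c·BᴴB) (W − c·BᴴB) ≥ κ for every matrix B and
every c ∈ ℂ: W is uniformly far (in L) from the complex ray of positive-semidefinite matrices (for
Hermitian W = W₊ − W₋: min(‖W₊‖²,‖W₋‖²) ≥ κ). Proof sketch (checked): (1) PRICE OF POSITIVITY: for P
⪰ 0 with Tr P² = 1 the repulsive energy E(P) = Re⟨P, liebOp K L U P⟩ = 2Tr(K P²) +
UΣ_x‖P^{1/2}L_xP^{1/2}‖²_HS ≥ E_free(N) + UΣ_x⟨n_x↑⟩² ≥ E_free(N) + U n²/L² (Cauchy–Schwarz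
⟨n_x↑n_x↓⟩ = ‖P^{1/2}L_xP^{1/2}‖² ≥ (Tr(P^{1/2}L_xP^{1/2}·P))² = ⟨n_x↑⟩²: positivity forbids the
correlation hole; then Jensen over x) — the paramagnetic Hartree–Fock energy; (2) CORRELATION-ENERGY
FLOOR (the real step): E_GS ≤ E_fre -/
@[route_item "route-HubbardSuperconductivity-PositivityPins"]
def SignBudget : Prop :=
  ∀ U : ℝ, 0 < U → ∀ δ ∈ Set.Ioo (0:ℝ) 1, ∃ κ : ℝ, 0 < κ ∧ ∃ L₀ : ℕ, ∀ L : ℕ, Even L → L₀ ≤ L → ∀ (ψ : Literature.MathematicalPhysics.QuantumLattice.Fock (Literature.MathematicalPhysics.QuantumLattice.Orb (Literature.MathematicalPhysics.QuantumLattice.FermionTorus 2 L))), star ψ ⬝ᵥ ψ = 1 → Literature.MathematicalPhysics.QuantumLattice.IsGroundStateInSector (Literature.MathematicalPhysics.QuantumLattice.hubbardTorus 2 L 1 U) (2 * ⌊(1 - δ) * (L : ℝ) ^ 2 / 2⌋₊) 0 ψ → ∀ (B : Matrix (Literature.MathematicalPhysics.QuantumLattice.Config (Literature.MathematicalPhysics.QuantumLattice.FermionTorus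 2 L) ⌊(1 - δ) * (L : ℝ) ^ 2 / 2⌋₊) (Literature.MathematicalPhysics.QuantumLattice.Config (Literature.MathematicalPhysics.QuantumLattice.FermionTorus 2 L) ⌊(1 - δ) * (L : ℝ) ^ 2 / 2⌋₊) ℂ) (c : ℂ), κ ≤ (Literature.MathematicalPhysics.QuantumLattice.hsInner (Literature.MathematicalPhysics.QuantumLattice.liebW ⌊(1 - δ) * (L : ℝ) ^ 2 / 2⌋₊ ψ - c • (Bᴴ * B)) (Literature.MathematicalPhysics.QuantumLattice.liebW ⌊(1 - δ) * (L : ℝ) ^ 2 / 2⌋₊ ψ - c • (Bᴴ * B))).re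

/-- item stmt-HubbardSuperconductivity-1906 · assembly · rank 1 · closed · moot by None · by planner
sources: LiebPRL1989, KomaTasaki1994, Scalapino1995
[assembly] AttrB1gPseudoGap → AttrEvenConvexity → AttractiveExclusion (the shared NoGo decl; the
summit link is NoGo's own Assembly NogoThesis → ¬HubbardSuperconductivity — no U<0 ⇒ ¬S chain is
claimed). NOT pure logic: the glue is the card's mechanism, all provable now and filed as support —
TraceLemma (ψ_{N_L}, ψ_{N_L−2} rotation-invariant at U<0) + Schur (Γ(r)Δ_dΓ(r)⁻¹ = −Δ_d by
dWaveFormFactor_rotate_holds ⇒ Δ_dψ_{N_L} ∈ V_L := szSector(N_L−2) 0 ⊓ {Γ(r) = −1}) + ChannelKT ⇒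
(minEnergyOn H V_L − E(N_L−2) + Δ₂(N_L))·‖Δ_dψ_{N_L}‖² ≤ C(U)L² ⇒ by the two cruxes L⁻⁴·Re⟨ψ,
Δ_d†Δ_d ψ⟩ ≤ C/(L²(g_L + Δ₂)) → 0 along even L ⇒ (expect_pairField_conjTranspose_mul: ⟨Δ_d†Δ_d⟩ =
Σ_{x,y} pairFieldCorr; torusProj_bijOn_halfOpenBox) the liminf in HasTorusLRO is ≤ 0 ⇒
¬HasPairFieldLRO for the sequence ψ_L := the (unique, Lieb) normalised sector ground state at each L
(existence of a normalised ground state in the nonempty finite-dimensional sector szSector N_L 0,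
N_L ≤ L² · 2, at every L incl. odd and L ≤ 2, where nothing else is required). Est. 1.5–3k Lean
lines on top of the three support items. || Sources: LiebPRL1989, KomaTasaki1994, Scalapino1995. -/
@[route_item "route-HubbardSuperconductivity-PositivityPins"]
def Assembly : Prop :=
  AttrB1gPseudoGap → AttrEvenConvexity → AttractiveExclusion

end Summit.HubbardSuperconductivity.HubbardSuperconductivity.Theses.PositivityPins
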